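import Summits.Ventures.LatticeQCDFlow.Scaling.EntropicTransportSteps
import Summits.Ventures.LatticeQCDFlow.Scaling.FatPartition

/-!
# LatticeQCDFlow / Scaling — TRANSPORT LAWS WITHOUT EXACTNESS, THE TOOL: a `K'`-co-Lipschitz map raises the free energy of ANY ensemble by at most `#E·(log(A/a) + κ·log 4K')`

HONEST FRAMING: exact (Metropolis-corrected) sampling algorithms for lattice gauge theory; figures of merit are
autocorrelation/cost numbers at stated couplings and volumes; no continuum-physics claim.

Venture `LatticeQCDFlow` (cell pub-lqcd), topic `Scaling`, FANOUT row 29 (theory-2) — OUR WORK (THEORY-2.md §3.3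
v2.9, the tool behind the mean-action transport laws `Scaling/MeanActionTransport.lean`).  Write `π = Haar^{⊗E}`,
`μ_β = μ_{Λ,β}` (Wilson measure of a continuous `ρ` with `Re tr ρ ≤ N`), `Z_β = Z_Λ(β)`, `⟨S⟩_β` the mean Wilson
action, and assume two-sided ball volumes `a·r^κ ≤ Haar(B̄(g,r)) ≤ A·r^κ` (`r ≤ 1` below).  The tree's STEP 2′
(`neg_log_partitionFunction_sub_le_between`, item 57) is a POINTWISE inequality for an EXACT co-Lipschitz transport
`T_* μ_{β₀} = μ_β`.  This file removes exactness: for EVERY `μ_{β₀}`-a.e.-measurable `K'`-co-Lipschitz map `T`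
(`AntilipschitzWith K' T`, sup metric on `G^E`; no push-forward condition at all) and every `β₀, β ≥ 0`,

  `log Z_{β₀} - log Z_β + β₀·⟨S⟩_{β₀} - β·∫ S∘T dμ_{β₀} ≤ #E·(log(A/a) + κ·log 4 + κ·log K')`

(`neg_log_partitionFunction_sub_integral_le_of_antilipschitz`) — the INTEGRATED STEP 2′, which survives because it
is the Gibbs variational principle `log Z_β ≥ -β·E_q S - D(q ‖ π)` at the model `q = T_*μ_{β₀}` combined with
"a `K'`-co-Lipschitz map raises `D(· ‖ π)` by at most `dim·log K'`"; equivalently (Gibbs identity, `gibbsIdentity`)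

  `D(μ_β ‖ π) - D(μ_{β₀} ‖ π) ≤ #E·(log(A/a) + κ·log 4 + κ·log K') + β·(∫ S∘T dμ_{β₀} - ⟨S⟩_β)`

(`klDiv_sub_klDiv_le_of_antilipschitz_meanAction`): the entropic contraction inequality of item 57 with exactness
replaced by the MEAN-ACTION DEFECT `E_{T_*μ_{β₀}} S - ⟨S⟩_β` of the model (`= 0` for an exact transport).  PROOF at
finite resolution (no density, no Lebesgue differentiation, no `D(q ‖ π)`): take the fat measurable partition
`B̄(n_i, δ/2) ⊆ c_i ⊆ B̄(n_i, δ)` of `Scaling/FatPartition.lean`; compare the cell masses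
`q_i = μ_{β₀}(T⁻¹c_i) ≤ Z_{β₀}⁻¹ e^{-β₀(S(x_i)-η)} (A(2K'δ)^κ)^{#E}` (a co-Lipschitz preimage of a cell lies in ONE
ball of radius `2K'δ` about any of its points `x_i`) with `Z_β ≥ Σ_i e^{-β(S(Tx_i)+η)} (a(δ/2)^κ)^{#E}` over the
charged cells, through the finite Jensen inequality `log Σ_i b_i ≥ Σ_i q_i log(b_i/q_i)`; the radius cancels and
`η → 0` by uniform continuity of `S`.  Elementary given the tree; nothing here is cited as a fact.  Reading:
Cover–Thomas, *Elements of Information Theory* 2nd ed., Thm 12.1.1 (maximum entropy / Gibbs variational principle);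
Villani, *Topics in Optimal Transportation* (2003) §9.4 (entropy under Lipschitz push-forward).
-/

noncomputable section

namespace Summit.Ventures.LatticeQCDFlow.Theory2.Lattice

open MeasureTheory InformationTheory Metric Set Literature.MathematicalPhysics.QuantumFieldTheory

section Tools

variable {N : ℕ} {G : Type} [Group G] [MetricSpace G] [IsTopologicalGroup G] [CompactSpace G]
  [MeasurableSpace G] [BorelSpace G] (ρ : G →* Matrix (Fin N) (Fin N) ℂ)

/-- **THE INTEGRATED STEP 2′ WITHOUT EXACTNESS** (OURS): for every `μ_{Λ,β₀}`-a.e.-measurable `K'`-co-Lipschitz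
map `T` of `G^E` (sup metric; `K' > 0`; NO push-forward condition), every `β₀, β ≥ 0` and two-sided ball volumes,
`log Z_Λ(β₀) - log Z_Λ(β) + β₀·⟨S⟩_{Λ,β₀} - β·∫ S∘T dμ_{Λ,β₀} ≤ #E·(log(A/a) + κ·log 4 + κ·log K')`.
Finite-resolution proof: fat partition at scale `δ` (`Scaling/FatPartition.lean`), cell masses of `T_*μ_{Λ,β₀}` bounded through ONE ball of
radius `2K'δ` about a preimage point, `Z_Λ(β)` bounded below on the charged cells, finite Jensen; the radius
cancels, `δ → 0`. [folklore] -/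
theorem neg_log_partitionFunction_sub_integral_le_of_antilipschitz {d L : ℕ} [NeZero L]
    [SecondCountableTopology G]
    (hρ : Continuous (ρ : G → Matrix (Fin N) (Fin N) ℂ)) (htr : ∀ g, (ρ g).trace.re ≤ N)
    {κ : ℕ} {a A : ℝ} (ha : 0 < a) (hA : 0 < A)
    (hlo : ∀ (g : G) (r : ℝ), 0 < r → r ≤ 1 → a * r ^ κ ≤ (haarProbability G (closedBall g r)).toReal)
    (hup : ∀ (g : G) (r : ℝ), 0 < r → (haarProbability G (closedBall g r)).toReal ≤ A * r ^ κ)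
    {β₀ β : ℝ} (hβ₀ : 0 ≤ β₀) (hβ0 : 0 ≤ β) {T : GaugeConfig d L G → GaugeConfig d L G} {K' : NNReal}
    (hK'0 : 0 < (K' : ℝ)) (hT' : AntilipschitzWith K' T)
    (hTm : AEMeasurable T (wilsonMeasure (d := d) (L := L) ρ β₀)) :
    Real.log (partitionFunction (d := d) (L := L) ρ β₀).toReal -
        Real.log (partitionFunction (d := d) (L := L) ρ β).toReal +
        β₀ * wilsonExpectation (d := d) (L := L) ρ β₀ (wilsonAction (d := d) (L := L) ρ) -
        β * ∫ x, wilsonAction (d := d) (L := L) ρ (T x) ∂(wilsonMeasure (d := d) (L := L) ρ β₀) ≤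
      Fintype.card (Edge d L) * (Real.log (A / a) + κ * Real.log 4 + κ * Real.log K') := by
  classical
  set π : Measure (GaugeConfig d L G) := Measure.pi fun _ : Edge d L => haarProbability G with hπ
  set S : GaugeConfig d L G → ℝ := wilsonAction (d := d) (L := L) ρ with hSdef
  set μ₀ : Measure (GaugeConfig d L G) := wilsonMeasure (d := d) (L := L) ρ β₀ with hμ₀def
  have hScont : Continuous S := continuous_wilsonAction (d := d) (L := L) ρ hρ
  haveI hμ₀P : IsProbabilityMeasure μ₀ :=
    isProbabilityMeasure_wilsonMeasure_of_le (d := d) (L := L) ρ hρ htr hβ₀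
  set q : Measure (GaugeConfig d L G) := μ₀.map T with hqdef
  haveI hqP : IsProbabilityMeasure q := Measure.isProbabilityMeasure_map hTm
  set nE : ℕ := Fintype.card (Edge d L) with hnE
  set Mc : ℝ := nE * (Real.log (A / a) + κ * Real.log 4 + κ * Real.log K') with hMcdef
  have hZ0 : partitionFunction (d := d) (L := L) ρ β ≠ 0 := partitionFunction_ne_zero ρ hρ β
  have hZtop : partitionFunction (d := d) (L := L) ρ β ≠ ⊤ :=
    ne_top_of_le_ne_top ENNReal.one_ne_top (partitionFunction_le_one ρ htr hβ0)
  set Z : ℝ := (partitionFunction (d := d) (L := L) ρ β).toReal with hZdef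
  have hZpos : 0 < Z := ENNReal.toReal_pos hZ0 hZtop
  have hZ₀0 : partitionFunction (d := d) (L := L) ρ β₀ ≠ 0 := partitionFunction_ne_zero ρ hρ β₀
  have hZ₀top : partitionFunction (d := d) (L := L) ρ β₀ ≠ ⊤ :=
    ne_top_of_le_ne_top ENNReal.one_ne_top (partitionFunction_le_one ρ htr hβ₀)
  set Z₀ : ℝ := (partitionFunction (d := d) (L := L) ρ β₀).toReal with hZ₀def
  have hZ₀pos : 0 < Z₀ := ENNReal.toReal_pos hZ₀0 hZ₀top
  have hμW : ∀ B : Set (GaugeConfig d L G),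
      μ₀ B = (partitionFunction ρ β₀)⁻¹ * wilsonWeight ρ β₀ B := fun B => by
    show ((partitionFunction ρ β₀)⁻¹ • wilsonWeight ρ β₀) B = _
    rw [Measure.smul_apply, smul_eq_mul]
  have hq : ∀ B : Set (GaugeConfig d L G), MeasurableSet B → q B = μ₀ (T ⁻¹' B) := fun B hB =>
    Measure.map_apply_of_aemeasurable hTm hB
  have hWtop : ∀ B : Set (GaugeConfig d L G), wilsonWeight (d := d) (L := L) ρ β B ≠ ⊤ := fun B =>
    ne_top_of_le_ne_top hZtop (measure_mono (subset_univ B))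
  -- `S` is bounded and integrable (against `μ₀`, also after composing with `T`)
  obtain ⟨Cb, hCb⟩ := isCompact_univ.exists_bound_of_continuousOn (hScont.continuousOn (s := univ))
  have hSint : Integrable S μ₀ :=
    Integrable.of_bound hScont.aestronglyMeasurable Cb (ae_of_all _ fun U => hCb U (mem_univ U))
  have hSTint : Integrable (fun x => S (T x)) μ₀ :=
    Integrable.of_bound (hScont.measurable.comp_aemeasurable hTm).aestronglyMeasurable Cb
      (ae_of_all _ fun U => hCb (T U) (mem_univ _))
  have hE₀ : wilsonExpectation (d := d) (L := L) ρ β₀ (wilsonAction (d := d) (L := L) ρ) = ∫ x, S x ∂μ₀ := rfl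
  rw [hE₀]
  -- the slack
  refine le_of_forall_pos_le_add fun ε hε => ?_
  set η : ℝ := ε / (2 * (β + β₀) + 1) with hηdef
  have hη : 0 < η := by positivity
  have hηε : 2 * (β + β₀) * η ≤ ε := by
    rw [hηdef, mul_div_assoc', div_le_iff₀ (by positivity)]; nlinarith
  -- uniform continuity of `S` on the compact configuration space
  obtain ⟨θ, hθ, hθS⟩ :=
    Metric.uniformContinuous_iff.1 (CompactSpace.uniformContinuous_of_continuous hScont) η hη
  have hSclose : ∀ u v : GaugeConfig d L G, dist u v < θ → S v - η ≤ S u ∧ S u ≤ S v + η :=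
    fun u v huv => by
      have := hθS huv
      rw [Real.dist_eq] at this
      constructor <;> linarith [(abs_lt.1 this).1, (abs_lt.1 this).2]
  -- the scale `δ`: `δ ≤ 1/2`, `2δ < θ`, `2K'δ < θ`
  set δ : ℝ := min (1 / 2) (θ / (4 * ((K' : ℝ) + 1))) with hδdef
  have hδ0 : 0 < δ := lt_min (by norm_num) (by positivity)
  have hδ1 : δ ≤ 1 / 2 := min_le_left _ _
  have hδθ : δ ≤ θ / (4 * ((K' : ℝ) + 1)) := min_le_right _ _
  have hθ4 : θ / (4 * ((K' : ℝ) + 1)) ≤ θ / 4 :=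
    div_le_div_of_nonneg_left hθ.le (by norm_num) (by nlinarith [hK'0])
  have h2δ : 2 * δ < θ := by linarith
  have h2Kδ : 2 * K' * δ < θ := by
    have h1 : (K' : ℝ) * (θ / (4 * ((K' : ℝ) + 1))) ≤ θ / 4 := by
      rw [mul_div_assoc', div_le_div_iff₀ (by positivity) (by positivity)]; nlinarith
    have h2 : (K' : ℝ) * δ ≤ K' * (θ / (4 * ((K' : ℝ) + 1))) := mul_le_mul_of_nonneg_left hδθ hK'0.le
    linarith
  -- the fat partition at scale `δ` and one representative preimage point per charged cell
  obtain ⟨m, n, c, hcm, hcd, hcU, hcsub, hcsup⟩ := exists_fat_partition (X := GaugeConfig d L G) hδ0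
  have hrep : ∀ i, ∃ x : GaugeConfig d L G, (T ⁻¹' c i).Nonempty → T x ∈ c i := fun i => by
    by_cases h : (T ⁻¹' c i).Nonempty
    · exact ⟨h.some, fun _ => h.some_mem⟩
    · exact ⟨1, fun h' => absurd h' h⟩
  choose xr hxr using hrep
  have hmemc : ∀ y : GaugeConfig d L G, ∃ i, y ∈ c i := fun y => by
    have : y ∈ ⋃ i, c i := by rw [hcU]; exact mem_univ y
    exact mem_iUnion.1 this
  have huniq : ∀ (y : GaugeConfig d L G) (i j : Fin m), y ∈ c i → y ∈ c j → i = j := fun y i j hi hj => by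
    by_contra hij
    exact Set.disjoint_left.1 (hcd hij) hi hj
  -- (G1) a co-Lipschitz preimage of a cell lies in the ball of radius `2K'δ` about its representative
  have hG1 : ∀ i, ∀ u ∈ T ⁻¹' c i, dist u (xr i) ≤ 2 * K' * δ := fun i u hu => by
    have hne : (T ⁻¹' c i).Nonempty := ⟨u, hu⟩
    have h1 : dist (T u) (T (xr i)) ≤ 2 * δ :=
      calc dist (T u) (T (xr i)) ≤ dist (T u) (n i) + dist (T (xr i)) (n i) := dist_triangle_right _ _ _
        _ ≤ δ + δ := add_le_add (mem_closedBall.1 (hcsub i hu)) (mem_closedBall.1 (hcsub i (hxr i hne)))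
        _ = 2 * δ := by ring
    calc dist u (xr i) ≤ K' * dist (T u) (T (xr i)) := hT'.le_mul_dist u (xr i)
      _ ≤ K' * (2 * δ) := mul_le_mul_of_nonneg_left h1 K'.coe_nonneg
      _ = 2 * K' * δ := by ring
  -- (G2) a charged cell lies in the ball of radius `2δ` about the image of its representative
  have hG2 : ∀ i, (T ⁻¹' c i).Nonempty → ∀ U ∈ c i, dist U (T (xr i)) ≤ 2 * δ := fun i hne U hU =>
    calc dist U (T (xr i)) ≤ dist U (n i) + dist (T (xr i)) (n i) := dist_triangle_right _ _ _
      _ ≤ δ + δ := add_le_add (mem_closedBall.1 (hcsub i hU)) (mem_closedBall.1 (hcsub i (hxr i hne)))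
      _ = 2 * δ := by ring
  have hS1 : ∀ i, ∀ u ∈ T ⁻¹' c i, S (xr i) - η ≤ S u ∧ S u ≤ S (xr i) + η := fun i u hu =>
    hSclose u (xr i) (lt_of_le_of_lt (hG1 i u hu) h2Kδ)
  have hS2 : ∀ i, (T ⁻¹' c i).Nonempty → ∀ U ∈ c i, S (T (xr i)) - η ≤ S U ∧ S U ≤ S (T (xr i)) + η :=
    fun i hne U hU => hSclose U (T (xr i)) (lt_of_le_of_lt (hG2 i hne U hU) h2δ)
  -- cell masses of the model `q = T_*μ₀`
  obtain ⟨qc, hqc'⟩ : ∃ qc : Fin m → ℝ, ∀ i, qc i = (q (c i)).toReal := ⟨_, fun _ => rfl⟩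
  have hqc0 : ∀ i, 0 ≤ qc i := fun i => by rw [hqc']; exact ENNReal.toReal_nonneg
  have hqsum : ∑ i, qc i = 1 := by
    have h1 : ∑ i, q (c i) = 1 := by
      rw [← measure_univ (μ := q), ← hcU, measure_iUnion hcd hcm, tsum_fintype]
    have h2 := congrArg ENNReal.toReal h1
    rw [ENNReal.toReal_sum (fun i _ => measure_ne_top _ _), ENNReal.toReal_one] at h2
    rw [← h2]
    exact Finset.sum_congr rfl fun i _ => hqc' i
  have hqne : ∀ i, 0 < qc i → (T ⁻¹' c i).Nonempty := fun i hi => by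
    refine nonempty_of_measure_ne_zero (μ := μ₀) fun h0 => ?_
    have : qc i = 0 := by rw [hqc', hq _ (hcm i), h0, ENNReal.toReal_zero]
    linarith
  set I : Finset (Fin m) := Finset.univ.filter fun i => 0 < qc i with hI
  have hIq : ∀ i ∈ I, 0 < qc i := fun i hi => (Finset.mem_filter.1 hi).2
  have hIuniv : ∀ f : Fin m → ℝ, ∑ i ∈ I, qc i * f i = ∑ i, qc i * f i := fun f => by
    rw [hI, Finset.sum_filter_of_ne]
    intro i _ hne
    exact lt_of_le_of_ne (hqc0 i) (Ne.symm (left_ne_zero_of_mul hne))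
  have hqsumI : ∑ i ∈ I, qc i = 1 := by
    have := hIuniv fun _ => 1
    simp only [mul_one] at this
    rw [this, hqsum]
  have hIne : I.Nonempty := by
    by_contra h
    rw [Finset.not_nonempty_iff_eq_empty] at h
    rw [h, Finset.sum_empty] at hqsumI
    exact zero_ne_one hqsumI
  -- LOWER bound: `Z_β ≥ Σ_{charged} e^{-β(S(T x_i)+η)} (a(δ/2)^κ)^{#E}`
  obtain ⟨bc, hbc'⟩ : ∃ bc : Fin m → ℝ,
      ∀ i, bc i = Real.exp (-(β * (S (T (xr i)) + η))) * (a * (δ / 2) ^ κ) ^ nE := ⟨_, fun _ => rfl⟩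
  have hbpos : ∀ i, 0 < bc i := fun i => by rw [hbc']; positivity
  have hWc : ∀ i ∈ I, bc i ≤ (wilsonWeight (d := d) (L := L) ρ β (c i)).toReal := fun i hi => by
    have hne := hqne i (hIq i hi)
    have hSB : ∀ U ∈ c i, S U ≤ S (T (xr i)) + η := fun U hU => (hS2 i hne U hU).2
    have h3 := le_wilsonWeight_of_le ρ hβ0 (hcm i) hSB
    have h1 := pow_le_pi_closedBall ha.le hlo (n i) (half_pos hδ0) (by linarith)
    have h2 : (π (closedBall (n i) (δ / 2))).toReal ≤ (π (c i)).toReal :=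
      ENNReal.toReal_mono (measure_ne_top _ _) (measure_mono (hcsup i))
    have h4 := ENNReal.toReal_mono (hWtop (c i)) h3
    rw [ENNReal.toReal_mul, ENNReal.toReal_ofReal (Real.exp_pos _).le] at h4
    calc bc i = Real.exp (-(β * (S (T (xr i)) + η))) * (a * (δ / 2) ^ κ) ^ nE := hbc' i
      _ ≤ Real.exp (-(β * (S (T (xr i)) + η))) * (π (c i)).toReal :=
          mul_le_mul_of_nonneg_left (h1.trans h2) (Real.exp_pos _).le
      _ ≤ _ := h4
  have hZsum : Z = ∑ i, (wilsonWeight (d := d) (L := L) ρ β (c i)).toReal := by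
    rw [hZdef]
    unfold partitionFunction
    rw [← hcU, measure_iUnion hcd hcm, tsum_fintype, ENNReal.toReal_sum fun i _ => hWtop (c i)]
  have hbZ : ∑ i ∈ I, bc i ≤ Z :=
    calc ∑ i ∈ I, bc i ≤ ∑ i ∈ I, (wilsonWeight (d := d) (L := L) ρ β (c i)).toReal := Finset.sum_le_sum hWc
      _ ≤ ∑ i, (wilsonWeight (d := d) (L := L) ρ β (c i)).toReal :=
          Finset.sum_le_sum_of_subset_of_nonneg (Finset.filter_subset _ _) fun i _ _ => ENNReal.toReal_nonneg
      _ = Z := hZsum.symm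
  -- UPPER bound: `q_i ≤ Z₀⁻¹ e^{-β₀(S(x_i)-η)} (A(2K'δ)^κ)^{#E}` on charged cells
  obtain ⟨uc, huc'⟩ : ∃ uc : Fin m → ℝ,
      ∀ i, uc i = Z₀⁻¹ * (Real.exp (-(β₀ * (S (xr i) - η))) * (A * (2 * K' * δ) ^ κ) ^ nE) :=
    ⟨_, fun _ => rfl⟩
  have hqu : ∀ i ∈ I, qc i ≤ uc i := fun i hi => by
    have hsub : T ⁻¹' c i ⊆ closedBall (xr i) (2 * K' * δ) := fun u hu => mem_closedBall.2 (hG1 i u hu)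
    have hSB₀ : ∀ U ∈ closedBall (xr i) (2 * K' * δ), S (xr i) - η ≤ S U := fun U hU =>
      (hSclose U (xr i) (lt_of_le_of_lt (mem_closedBall.1 hU) h2Kδ)).1
    have h3₀ := wilsonWeight_le_of_le ρ hβ₀ measurableSet_closedBall hSB₀
    have h4 := pi_closedBall_le_pow hup (xr i) (by positivity : 0 < 2 * (K' : ℝ) * δ)
    have h5 : q (c i) ≤ (partitionFunction (d := d) (L := L) ρ β₀)⁻¹ *
        (ENNReal.ofReal (Real.exp (-(β₀ * (S (xr i) - η)))) * π (closedBall (xr i) (2 * K' * δ))) := by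
      rw [hq _ (hcm i)]
      calc μ₀ (T ⁻¹' c i) ≤ μ₀ (closedBall (xr i) (2 * K' * δ)) := measure_mono hsub
        _ ≤ _ := by rw [hμW]; exact mul_le_mul' le_rfl h3₀
    have hfin : (partitionFunction (d := d) (L := L) ρ β₀)⁻¹ *
        (ENNReal.ofReal (Real.exp (-(β₀ * (S (xr i) - η)))) * π (closedBall (xr i) (2 * K' * δ))) ≠ ⊤ :=
      ENNReal.mul_ne_top (ENNReal.inv_ne_top.2 hZ₀0)
        (ENNReal.mul_ne_top ENNReal.ofReal_ne_top (measure_ne_top _ _))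
    have h6 := ENNReal.toReal_mono hfin h5
    rw [ENNReal.toReal_mul, ENNReal.toReal_mul, ENNReal.toReal_inv,
      ENNReal.toReal_ofReal (Real.exp_pos _).le] at h6
    calc qc i = (q (c i)).toReal := hqc' i
      _ ≤ Z₀⁻¹ * (Real.exp (-(β₀ * (S (xr i) - η))) * (π (closedBall (xr i) (2 * K' * δ))).toReal) := h6
      _ ≤ uc i := by
          rw [huc']
          exact mul_le_mul_of_nonneg_left (mul_le_mul_of_nonneg_left h4 (Real.exp_pos _).le)
            (inv_nonneg.2 hZ₀pos.le)
  -- finite JENSEN: `Σ_I q_i log(b_i/q_i) ≤ log Σ_I b_i ≤ log Z_β`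
  have hJ : ∑ i ∈ I, qc i * Real.log (bc i / qc i) ≤ Real.log Z := by
    have hj := strictConcaveOn_log_Ioi.concaveOn.le_map_sum (t := I) (w := qc) (p := fun i => bc i / qc i)
      (fun i _ => hqc0 i) hqsumI (fun i hi => div_pos (hbpos i) (hIq i hi))
    simp only [smul_eq_mul] at hj
    have hsum : ∑ i ∈ I, qc i * (bc i / qc i) = ∑ i ∈ I, bc i :=
      Finset.sum_congr rfl fun i hi => by rw [mul_comm]; exact div_mul_cancel₀ _ (hIq i hi).ne'
    rw [hsum] at hj
    exact hj.trans (Real.log_le_log (Finset.sum_pos (fun i _ => hbpos i) hIne) hbZ)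
  -- per charged cell: `β₀S(x_i) - βS(Tx_i) + log Z₀ - (β+β₀)η - Mc ≤ log(b_i/q_i)` (the radius cancels)
  have hlog4 : Real.log 4 = 2 * Real.log 2 := by
    rw [show (4 : ℝ) = 2 ^ 2 by norm_num, Real.log_pow]; norm_num
  have hMc : Mc = nE * (Real.log A - Real.log a + κ * (2 * Real.log 2) + κ * Real.log K') := by
    rw [hMcdef, Real.log_div hA.ne' ha.ne', hlog4]
  have hcell : ∀ i ∈ I,
      β₀ * S (xr i) - β * S (T (xr i)) + Real.log Z₀ - (β + β₀) * η - Mc ≤ Real.log (bc i / qc i) :=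
    fun i hi => by
      have hq0 : 0 < qc i := hIq i hi
      rw [Real.log_div (hbpos i).ne' hq0.ne']
      have hlq : Real.log (qc i) ≤ Real.log (uc i) := Real.log_le_log hq0 (hqu i hi)
      have hlb : Real.log (bc i) =
          Real.log (Real.exp (-(β * (S (T (xr i)) + η))) * (a * (δ / 2) ^ κ) ^ nE) := by rw [hbc']
      rw [Real.log_mul (Real.exp_pos _).ne' (by positivity), Real.log_exp, Real.log_pow,
        Real.log_mul ha.ne' (by positivity), Real.log_pow, Real.log_div hδ0.ne' two_ne_zero] at hlb
      have hlu : Real.log (uc i) =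
          Real.log (Z₀⁻¹ * (Real.exp (-(β₀ * (S (xr i) - η))) * (A * (2 * K' * δ) ^ κ) ^ nE)) := by
        rw [huc']
      rw [Real.log_mul (inv_pos.2 hZ₀pos).ne' (by positivity), Real.log_inv,
        Real.log_mul (Real.exp_pos _).ne' (by positivity), Real.log_exp, Real.log_pow,
        Real.log_mul hA.ne' (by positivity), Real.log_pow,
        Real.log_mul (by positivity) hδ0.ne', Real.log_mul two_ne_zero hK'0.ne'] at hlu
      rw [hMc]
      linarith [hlq, hlb, hlu]
  -- summing over the charged cells with weights `q_i`
  have hmain : ∑ i ∈ I, qc i * (β₀ * S (xr i) - β * S (T (xr i))) +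
      (Real.log Z₀ - (β + β₀) * η - Mc) ≤ Real.log Z := by
    have h1 : ∑ i ∈ I, qc i * (β₀ * S (xr i) - β * S (T (xr i)) + Real.log Z₀ - (β + β₀) * η - Mc) ≤
        ∑ i ∈ I, qc i * Real.log (bc i / qc i) :=
      Finset.sum_le_sum fun i hi => mul_le_mul_of_nonneg_left (hcell i hi) (hqc0 i)
    have h2 : ∀ i ∈ I, qc i * (β₀ * S (xr i) - β * S (T (xr i)) + Real.log Z₀ - (β + β₀) * η - Mc) =
        qc i * (β₀ * S (xr i) - β * S (T (xr i))) + qc i * (Real.log Z₀ - (β + β₀) * η - Mc) :=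
      fun i _ => by ring
    rw [Finset.sum_congr rfl h2, Finset.sum_add_distrib, ← Finset.sum_mul, hqsumI, one_mul] at h1
    exact h1.trans hJ
  have hsplit : ∑ i ∈ I, qc i * (β₀ * S (xr i) - β * S (T (xr i))) =
      β₀ * ∑ i, qc i * S (xr i) - β * ∑ i, qc i * S (T (xr i)) := by
    rw [hIuniv, Finset.mul_sum, Finset.mul_sum, ← Finset.sum_sub_distrib]
    exact Finset.sum_congr rfl fun i _ => by ring
  -- (I1) `⟨S⟩_{β₀} ≤ Σ q_i S(x_i) + η`: integrate `S ≤ Σ_i 1_{c_i}(T·)(S(x_i)+η)` against `μ₀`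
  have hFgen : ∀ g : Fin m → ℝ, ∀ (y : GaugeConfig d L G) (i : Fin m), y ∈ c i →
      (∑ j, (c j).indicator (fun _ => g j) y) = g i := fun g y i hy => by
    rw [Finset.sum_eq_single i (fun j _ hji => ?_) (fun h => absurd (Finset.mem_univ i) h), indicator_of_mem hy]
    exact indicator_of_notMem (fun hyj => hji (huniq y j i hyj hy)) _
  have hFint : ∀ g : Fin m → ℝ, ∫ y, (∑ j, (c j).indicator (fun _ => g j) y) ∂q = ∑ j, qc j * g j := fun g => by
    rw [integral_finsetSum _ fun j _ => (integrable_const (g j)).indicator (hcm j)]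
    refine Finset.sum_congr rfl fun j _ => ?_
    rw [integral_indicator_const _ (hcm j), smul_eq_mul, measureReal_def, hqc']
  have hFmeas : ∀ g : Fin m → ℝ, Measurable fun y => ∑ j, (c j).indicator (fun _ => g j) y := fun g =>
    Finset.measurable_sum _ fun j _ => measurable_const.indicator (hcm j)
  have hFbd : ∀ g : Fin m → ℝ, ∀ y, ‖∑ j, (c j).indicator (fun _ => g j) y‖ ≤ ∑ j, |g j| := fun g y => by
    obtain ⟨i, hi⟩ := hmemc y
    rw [hFgen g y i hi, Real.norm_eq_abs]
    exact Finset.single_le_sum (f := fun j => |g j|) (fun j _ => abs_nonneg _) (Finset.mem_univ i)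
  have hFTint : ∀ g : Fin m → ℝ, Integrable (fun x => ∑ j, (c j).indicator (fun _ => g j) (T x)) μ₀ := fun g =>
    Integrable.of_bound ((hFmeas g).comp_aemeasurable hTm).aestronglyMeasurable (∑ j, |g j|)
      (ae_of_all _ fun x => hFbd g (T x))
  have hFmap : ∀ g : Fin m → ℝ, ∫ x, (∑ j, (c j).indicator (fun _ => g j) (T x)) ∂μ₀ = ∑ j, qc j * g j :=
    fun g => by rw [← hFint g, hqdef, integral_map hTm (hFmeas g).aestronglyMeasurable]
  have hI1 : ∫ x, S x ∂μ₀ ≤ ∑ i, qc i * S (xr i) + η := by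
    have hle : ∀ x, S x ≤ ∑ j, (c j).indicator (fun _ => S (xr j) + η) (T x) := fun x => by
      obtain ⟨i, hi⟩ := hmemc (T x)
      rw [hFgen (fun j => S (xr j) + η) (T x) i hi]
      exact (hS1 i x hi).2
    have h1 := integral_mono hSint (hFTint fun j => S (xr j) + η) hle
    rw [hFmap fun j => S (xr j) + η] at h1
    have h2 : ∑ j, qc j * (S (xr j) + η) = ∑ j, qc j * S (xr j) + η := by
      rw [Finset.sum_congr rfl fun j _ => mul_add (qc j) (S (xr j)) η, Finset.sum_add_distrib,
        ← Finset.sum_mul, hqsum, one_mul]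
    linarith
  -- (I2) `∫ S∘T dμ₀ ≥ Σ q_i S(T x_i) - η`
  have hI2 : ∑ i, qc i * S (T (xr i)) - η ≤ ∫ x, S (T x) ∂μ₀ := by
    have hle : ∀ x, (∑ j, (c j).indicator (fun _ => S (T (xr j)) - η) (T x)) ≤ S (T x) := fun x => by
      obtain ⟨i, hi⟩ := hmemc (T x)
      rw [hFgen (fun j => S (T (xr j)) - η) (T x) i hi]
      exact (hS2 i ⟨x, hi⟩ (T x) hi).1
    have h1 := integral_mono (hFTint fun j => S (T (xr j)) - η) hSTint hle
    rw [hFmap fun j => S (T (xr j)) - η] at h1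
    have h2 : ∑ j, qc j * (S (T (xr j)) - η) = ∑ j, qc j * S (T (xr j)) - η := by
      rw [Finset.sum_congr rfl fun j _ => mul_sub (qc j) (S (T (xr j))) η, Finset.sum_sub_distrib,
        ← Finset.sum_mul, hqsum, one_mul]
    linarith
  -- assemble
  rw [hsplit] at hmain
  have hb₀ := mul_le_mul_of_nonneg_left hI1 hβ₀
  have hb := mul_le_mul_of_nonneg_left hI2 hβ0
  linarith [hmain, hb₀, hb, hηε, hη]

/-- **THE ENTROPIC CONTRACTION INEQUALITY WITHOUT EXACTNESS** (OURS): for every `μ_{Λ,β₀}`-a.e.-measurable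
`K'`-co-Lipschitz map `T` (`K' > 0`; `β₀, β ≥ 0` in either order) and two-sided ball volumes,
`D(μ_{Λ,β} ‖ Haar^{⊗E}) - D(μ_{Λ,β₀} ‖ Haar^{⊗E}) ≤ #E·(log(A/a) + κ·log 4 + κ·log K') + β·(∫ S∘T dμ_{Λ,β₀} - ⟨S⟩_{Λ,β})`:
the exact inequality `klDiv_sub_klDiv_le_of_antilipschitz` with the push-forward condition replaced by the
MEAN-ACTION DEFECT of the model `T_*μ_{Λ,β₀}` (maximum-entropy principle: among laws with a given mean action the
Wilson measure has the least entropy deficit).  Proof: the integrated STEP 2′ read through the Gibbs identity.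
[folklore] -/
theorem klDiv_sub_klDiv_le_of_antilipschitz_meanAction {d L : ℕ} [NeZero L] [SecondCountableTopology G]
    (hρ : Continuous (ρ : G → Matrix (Fin N) (Fin N) ℂ)) (htr : ∀ g, (ρ g).trace.re ≤ N)
    {κ : ℕ} {a A : ℝ} (ha : 0 < a) (hA : 0 < A)
    (hlo : ∀ (g : G) (r : ℝ), 0 < r → r ≤ 1 → a * r ^ κ ≤ (haarProbability G (closedBall g r)).toReal)
    (hup : ∀ (g : G) (r : ℝ), 0 < r → (haarProbability G (closedBall g r)).toReal ≤ A * r ^ κ)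
    {β₀ β : ℝ} (hβ₀ : 0 ≤ β₀) (hβ0 : 0 ≤ β) {T : GaugeConfig d L G → GaugeConfig d L G} {K' : NNReal}
    (hK'0 : 0 < (K' : ℝ)) (hT' : AntilipschitzWith K' T)
    (hTm : AEMeasurable T (wilsonMeasure (d := d) (L := L) ρ β₀)) :
    (klDiv (wilsonMeasure (d := d) (L := L) ρ β) (Measure.pi fun _ : Edge d L => haarProbability G)).toReal -
        (klDiv (wilsonMeasure (d := d) (L := L) ρ β₀) (Measure.pi fun _ : Edge d L => haarProbability G)).toReal ≤
      Fintype.card (Edge d L) * (Real.log (A / a) + κ * Real.log 4 + κ * Real.log K') +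
        β * (∫ x, wilsonAction (d := d) (L := L) ρ (T x) ∂(wilsonMeasure (d := d) (L := L) ρ β₀) -
          wilsonExpectation (d := d) (L := L) ρ β (wilsonAction (d := d) (L := L) ρ)) := by
  rw [gibbsIdentity d N G ρ hρ htr L β₀ hβ₀, gibbsIdentity d N G ρ hρ htr L β hβ0]
  have h := neg_log_partitionFunction_sub_integral_le_of_antilipschitz ρ hρ htr ha hA hlo hup hβ₀ hβ0 hK'0 hT' hTm
  linarith

end Tools

end Summit.Ventures.LatticeQCDFlow.Theory2.Lattice
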